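import Summits.HodgeConjecture.HodgeCM.Model.LiuIndexCentralType_1

/-! PORT of `HodgeCM/Model/LiuIndexCentralType.lean` (HodgeCMPerL run 82) — part 2: continuation of `Summits.HodgeConjecture.HodgeCM.Model.LiuIndexCentralType_1` (split at a top-level declaration boundary by port_pkg.py; scope re-opened below; declarations unchanged). -/

-- port_pkg: scope re-opened for this part (file-level context, then the namespace/section stack open at the cut)
set_option autoImplicit false
noncomputable section
open NumberField NumberField.InfinitePlace NumberField.mixedEmbedding
open scoped Matrix SchwartzMap Classical
open Literature.NumberTheory.Automorphic Literature.NumberTheory.Automorphic.UnitaryGroup Literature.NumberTheory.Weil1964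
open Literature.RepresentationTheory.KonnoKonno2007 Literature.RepresentationTheory.KonnoKonno2007.RealDualPair
open Literature.NumberTheory.GelbartRogawski1991 Literature.NumberTheory.GelbartRogawski1991.UnitaryDualPair
open Literature.Analysis.SegalBargmann
open HodgeCM.Model.SupplyInstance (testFun archEmb)
namespace HodgeCM.Model
open HodgeCM.Model.ArchSideTerm (e₁ testFun_smul exists_apply_archEmb_ne_zero lineCenterChar lineCenterChar_vacuum
  cmPairRep_cmCenter_inf_one_testFun)
namespace LiuIndex
variable {L : CMField} {ι₁ : (L : Type) →+* ℂ} (V : HermSpace3 L ι₁)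
variable (ρ : GramClass L → RealScalar L)
variable {ρ} in
/-- **THE POINTED CONSTRUCTOR** (binder-2-g19 SEAM NOTE 2; #S15 `exists_lineOf_eq_ofCM`): if the section puts `a` itself over `q` (`ρ q = a`;
for `ρ := LiuIndex.repAt a`, `q := GramClass.mk a` this is #103 `repAt_mk_self`), a compatible splitting `s` AT `a` of central type `μ ⟦a⟧`
— checked at the slot's OWN scalar (e.g. by `pairRep_splittingOf_center_testFun_gaussianAt` + (F1)'s closed form) — is an index over `q` whose
line is `SplitLineE.ofCM V e₁ (vec a) … s …` ON THE NOSE: an `Eq` of `SplitLineE V` records for #103 §2 `mem_biSup_block_pin_of_line_eq`. -/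
theorem I.exists_line_eq_ofCM (μ : GramClass L → InfinitePlace (L : Type) → ℤ) {q : GramClass L} {a : RealScalar L} (h : ρ q = a)
    (s : SplittingAt V a) (hs : IsCompatAtScalar V a s) (hm : HasCentralTypeAt V a s (μ (GramClass.mk a))) :
    ∃ j : I V ρ μ, j.1 = q ∧
      line V ρ μ j = SplitLineE.ofCM V e₁ (RealScalar.vec a) (RealScalar.vec_real a) (RealScalar.vec_ne a) s hs :=
  exists_lineOf_eq_ofCM V h s hs hm

variable {ρ} in
/-- the pointed constructor AT THE [GR91, Prop. 3.1.1] SPLITTING OF RECORD `splittingOf hGR` (#102 `SplitLineE.ofCMOf`; the shape of a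
slot record built from a `CompatibleSplitting` witness `hGR` at the slot scalar `a`). -/
theorem I.exists_line_eq_ofCMOf (μ : GramClass L → InfinitePlace (L : Type) → ℤ) {q : GramClass L} {a : RealScalar L} (h : ρ q = a)
    (hGR : (cmSplittingDatum (L : Type) e₁ (frameD V) (frameD_real V) (frameD_ne V) (RealScalar.vec a) (RealScalar.vec_real a)
      (RealScalar.vec_ne a)).CompatibleSplitting)
    (hm : HasCentralTypeAt V a (SplitLineE.ofCMOf V e₁ (RealScalar.vec a) (RealScalar.vec_real a) (RealScalar.vec_ne a) hGR).s
      (μ (GramClass.mk a))) :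
    ∃ j : I V ρ μ, j.1 = q ∧ line V ρ μ j = SplitLineE.ofCMOf V e₁ (RealScalar.vec a) (RealScalar.vec_real a) (RealScalar.vec_ne a) hGR :=
  I.exists_line_eq_ofCM V μ h _ (SplitLineE.ofCMOf V e₁ (RealScalar.vec a) (RealScalar.vec_real a) (RealScalar.vec_ne a) hGR).hs hm

variable {ρ} in
/-- **at the pin, the record of record is an index line of recipe `μ` iff the recipe reads the record's own central type at its class**
(`centralTypeOf`, §2c): the hypothesis-free form of `I.exists_line_eq_ofCMOf`. [folklore] -/
theorem I.exists_line_eq_ofCMOf_of_eq (μ : GramClass L → (InfinitePlace (L : Type) → ℤ)) {q : GramClass L} {a : RealScalar L} (h : ρ q = a)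
    (hGR : (cmSplittingDatum (L : Type) e₁ (frameD V) (frameD_real V) (frameD_ne V) (RealScalar.vec a) (RealScalar.vec_real a)
      (RealScalar.vec_ne a)).CompatibleSplitting)
    (hμ : μ (GramClass.mk a) = centralTypeOf V a hGR) :
    ∃ j : I V ρ μ, j.1 = q ∧
      line V ρ μ j = SplitLineE.ofCMOf V e₁ (RealScalar.vec a) (RealScalar.vec_real a) (RealScalar.vec_ne a) hGR :=
  I.exists_line_eq_ofCMOf V μ h hGR ((hasCentralTypeAt_ofCMOf_iff_eq_centralTypeOf V a hGR _).2 hμ)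

variable {ρ} in
/-- the pointed constructor FOR A TWISTED RECORD `(ofCM … s hs) ⊗ ĉ` (axioms-1 #7 `SplitLine.twistBy`; the shape of a slot record twisted by a
rationally-trivial character `ĉ` of `G₁(𝔸_{L⁺})`, e.g. an `η`-twist): the twist stays inside the index's splitting coordinate. -/
theorem I.exists_line_eq_twistBy (μ : GramClass L → InfinitePlace (L : Type) → ℤ) {q : GramClass L} {a : RealScalar L} (h : ρ q = a)
    (s : SplittingAt V a) (hs : IsCompatAtScalar V a s)
    (ĉ : (SplitLineE.ofCM V e₁ (RealScalar.vec a) (RealScalar.vec_real a) (RealScalar.vec_ne a) s hs).BigChar)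
    (hĉ : (SplitLineE.ofCM V e₁ (RealScalar.vec a) (RealScalar.vec_real a) (RealScalar.vec_ne a) s hs).IsRatTrivial ĉ)
    (hm : HasCentralTypeAt V a
      ((SplitLineE.ofCM V e₁ (RealScalar.vec a) (RealScalar.vec_real a) (RealScalar.vec_ne a) s hs).twistBy ĉ hĉ).s (μ (GramClass.mk a))) :
    ∃ j : I V ρ μ, j.1 = q ∧
      line V ρ μ j = (SplitLineE.ofCM V e₁ (RealScalar.vec a) (RealScalar.vec_real a) (RealScalar.vec_ne a) s hs).twistBy ĉ hĉ :=
  I.exists_line_eq_ofCM V μ h _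
    ((SplitLineE.ofCM V e₁ (RealScalar.vec a) (RealScalar.vec_real a) (RealScalar.vec_ne a) s hs).twistBy ĉ hĉ).hs hm

end LiuIndex

end HodgeCM.Model

-- port_pkg: scope closed for this part
end
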